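import Literature.Analysis.FluidPDE.OnsagerBDSVStages
import Literature.Analysis.FluidPDE.FractionalNSReynolds
import Literature.Analysis.FluidPDE.DeRosaThreeStages
import Literature.Analysis.FluidPDE.OnsagerBDSVThreeStagesProofs
import Literature.Analysis.FluidPDE.OnsagerFlexibilityProofs
import HarnessLib

/-!
# De Rosa's convex-integration scheme: the stage estimates consumed by the proof of the
# inductive proposition, from the three stages (theorem)

L. De Rosa, *Infinitely many Leray–Hopf solutions for the fractional Navier–Stokes equations*,
Comm. PDE 44 (2019) 335–365 = arXiv:1801.10235, proves his main iterative proposition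
(Prop. 4.1; in the tree, in the regime `γ < β` covered by its printed proof,
`DeRosa.iterativeSchemeLT` = Prop. 4.1 run from zero and `DeRosa.inductiveStepLT` = one step along
a construction history, both in `DeRosaStep.lean`) in
§5 by the three stages of Buckmaster–De Lellis–Székelyhidi–Vicol (BDSV) adapted to the
fractional Navier–Stokes–Reynolds system (NSR): *mollification* (§5.1, Prop. 5.1),
*gluing of exact smooth solutions of the fractional Navier–Stokes system* (§5.2, Cor. 5.2,
Props. 5.3–5.5, using the local existence and stability results of §3) and *perturbation by
Mikado flows* (§§5.3–5.5, Lemmas 5.6–5.10, Props. 5.11–5.13, with the new dissipative error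
`R̊^D_{q+1} = ν ℛ(-Δ)^γ w_{q+1}`). The last half page is verbatim BDSV's: "Then Proposition 4.1
is just a consequence of estimates (5.19)–(5.21), Proposition 5.1 and Proposition 5.5 (again, a
detailed proof can be found in [BDLSV2017])" (§5.3, p. 14), i.e. the "Proof of Proposition 2.1"
of BDSV §2.6, which consumes seven displayed estimates of the stages and closes the induction by
triangle inequalities and a parameter inequality. The tree has that argument for the Euler
scheme: `BDSV.stagesEstimate → BDSV.mainIteration` (`OnsagerBDSVStagesProofs.lean`).

This file records the fractional twin of `BDSV.stagesEstimate_of_threeStages`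
(`OnsagerBDSVThreeStagesProofs.lean`): under the hypotheses of Prop. 4.1 in the regime `γ < β`
covered by the printed proof, the three stages produce from the stage-`q` triple fields `v_ℓ`,
`v̄_q` and a smooth solution `(v_{q+1}, p_{q+1}, R̊_{q+1})` of (NSR) on `[0,T] × 𝕋³` satisfying
(5.5), (5.6)|_{N=0}, (5.13)|₀, (5.15)|_{N=0}, (5.19), (5.20) (in the form of Prop. 5.13) and
(5.21) (Prop. 5.12), whose time-zero velocity slice depends on the profile and the input only
through `(e(0), v_q(·,0))`. Until 2026-08-15 this statement was the named fact
`DeRosa.stagesEstimate`, a waypoint of the decomposition of Prop. 4.1; it was retired (D-0026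
review: not a distinct published result but the juxtaposition of the outputs of Props. 5.1, 5.5,
5.11–5.13) in favour of the theorem below, whose hypotheses are the three stage facts, each a
distinct block of §5 with its own locator.

* **theorem** `DeRosa.stageEstimates_of_threeStages`: the seven estimates and the
  time-zero clause PROVED from the three stage facts `DeRosa.mollificationStage` (Prop. 5.1),
  `DeRosa.gluingStage` (§5.2) and `DeRosa.perturbationStage` (§§5.3–5.5) of
  `DeRosaThreeStages.lean` — the fractional twin of `BDSV.stagesEstimate_of_threeStages`: the
  constants are threaded (mollification constants into the gluing stage, gluing constant into
  the perturbation stage), the energy gap of §5.3 "`δ_{q+1}/(2λ_q^α) ≤ e(t) - ∫|v̄_q|² ≤ 2δ_{q+1}`"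
  follows from (4.10), (5.8), (5.18) for `a` large, `‖v̄_q‖₀ ≤ 3` from (4.9), (5.5), (5.13), the
  spatial Hölder bound of `v_q` is passed to `v_ℓ` (mollification) and to `v̄_q` (interpolation
  of (5.13)|₀ against (5.6)|₀ + (5.15)|₀: `[v̄_q - v_ℓ]_θ ≲ (δ_{q+1}^{1/2})^{1-θ}(δ_q^{1/2}λ_q)^θ ≤ 1`
  for `a` large since `θ < β`, `b ≥ 1`), and the time-zero maps compose
  (`v̄_q(·,0) = v_ℓ(·,0) = Ψ₁(v_q(·,0))`, `v_{q+1}(·,0) = Ψ₃(e(0))(v̄_q(·,0))`).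

The assembly "three stages → `DeRosa.inductiveStepLT` → `DeRosa.iterativeSchemeLT`"
(`DeRosa.inductiveStepLT_of_threeStages`: the printed half page plus the derivation, along a
construction history, of the Hölder bound the stages consume) is `DeRosaStagesProofs.lean`; the
stages themselves (whose statements need higher Hölder norms and material derivatives,
Props. 5.1, 5.3–5.5, 5.11–5.13) are the named facts of `DeRosaThreeStages.lean`.

## Transcription

* Everything common with BDSV is transcribed exactly as in `BDSV.stagesEstimate`
  (`OnsagerBDSVStages.lean`): parameters
  `λ_q = BDSV.freq a b q`, `δ_q = BDSV.amp β a b q` ((4.5)–(4.6)), `ℓ = BDSV.mollScale β α a b q`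
  ((5.3), identical with BDSV (2.10)′), sup norms `‖·‖₀`, `[·]₁` on `[0,T] × 𝕋³` as the predicates
  `BDSV.SupLE`, `BDSV.DerivSupLE` (§3 of the paper = BDSV App. A), `‖f‖₁ ≤ B` as
  `∃ B₀ B₁, … ∧ B₀ + B₁ ≤ B`, the inductive estimates (4.7)–(4.10) = `BDSV.InductiveEstimates`,
  (5.19) = `BDSV.VelocityIncrementBound (M/2)`, profiles (4.2) = `BDSV.IsNormalisedProfile`; the
  implicit constants of `≲` ("independent of `a, b` and `q`", footnote p. 9) are one real `C`
  fixed before `a₀`. (5.13) `‖v̄_q - v_ℓ‖_α ≲ δ_{q+1}^{1/2} ℓ^α` and (5.20)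
  `‖R̊_{q+1}‖_α ≲ …` are recorded through their `‖·‖₀` parts (all that the half page uses;
  Prop. 5.13 prints the `‖·‖₀` form).
* Triples are smooth solutions of (NSR) with exponent `γ` and viscosity `ν`,
  `Torus.IsFracNSReynoldsOn (Icc 0 T) γ ν` (`FractionalNSReynolds.lean`); as in `DeRosaScheme.lean`
  the normalisations (4.3) `tr R̊ = 0`, (4.4) `∫ p = 0` are not demanded, the viscosity
  `ν ∈ (0,1)` is quantified after `a` ("`ν` is just some small constant (in particular `ν < 1`)",
  §4.1; Prop. 5.3: "`0 < ν < 1`"; the constants of §3 are `ν`-independent), and so is `T > 0`.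
* **The Hölder hypothesis.** The proofs of (5.18) (p. 14: "since `‖v_q‖_γ ≤ 1` for every
  `γ < β` …, by (5.9), Theorem 7.1 and Cauchy–Schwarz") and of (5.31) (p. 15, the term
  `2ν ∫ |(-Δ)^{γ/2} v̄_q|²`) use a uniform spatial Hölder bound on the input velocity at an
  exponent strictly between the dissipation exponent `γ` and `β` — in the paper the bound
  `‖v_q‖_{γ'} ≤ 1` that §4.2 derives along the iteration from zero. It is made an explicit
  hypothesis here: an exponent `θ` with `γ < θ < β` (fixed with `β, γ, b`, so that the threshold
  `α₀` may depend on it) and a constant `C_H` (fixed before the implicit constant `C` and the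
  threshold `a₀`, which may depend on it) with `[v_q(t)]_{C^θ(𝕋³)} ≤ C_H` for all `t ∈ [0,T]`
  (`HolderWith C_H θ (v t)`, quotient metric of `𝕋³`). Accordingly the statement is in the
  regime `0 < γ < β < 1/3` of Thm. 1.2 and §4.3, the one the printed proof covers (see
  `DeRosaStep.lean`).
* **Time zero.** "`v_{q+1}(·,0)` depends only on `e(0)` and `v_q(·,0)`" (Prop. 4.1; §5.4: "the
  dependence of `w_{q+1}(·,0)` on the function `e(t)` is only trough the value `e(0)`"; indeed
  `v̄_q(·,0) = v_ℓ(·,0) = (v_q * ψ_ℓ)(·,0)` since `0 ∈ J₀` and `t₀ = 0`, `R̊̄_q(·,0) = 0`,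
  `Φ₀(·,0) = id`, and `w_{q+1}(·,0)` is determined by `ρ_q(0) = (e(0) - δ_{q+2}/2 - ∫|v̄_q(·,0)|²)/3`)
  is rendered, as in `DeRosa.StepAt`, by a map `Ψ` fixed after the parameters `…, a, ν, T, q` and
  before the profile and the input, with `v_{q+1}(·,0) = Ψ (e 0) (v_q(·,0))`.
* Quantifier prefix: that of Prop. 4.1 (`∃ M > 0` universal — §5.4, (5.37): `M = 64 M̄ ∑ |k|^{-4}`;
  `∀ β`; `∀ γ < β`; `∀ b` with (4.11); then `∀ θ ∈ (γ, β)`; `∃ α₀ > 0`; `∀ α ∈ (0, α₀)`; `∀ C_H`;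
  `∃ C, a₀ > 1`; `∀ a ≥ a₀`; `∀ ν ∈ (0,1)`; `∀ T > 0`; `∀ q`; `∃ Ψ`; inputs).

## References

* L. De Rosa, Comm. PDE 44 (2019), 335–365 = arXiv:1801.10235: §4.1 (Prop. 4.1, (4.2)–(4.12)),
  §5 ((5.1)–(5.4); Prop. 5.1 (5.5)–(5.8); (5.7); Prop. 5.5 (5.13)–(5.18) and its proof, p. 14;
  §5.3 (5.19)–(5.21) and "Then Proposition 4.1 is just a consequence …"; Lemma 5.9 and its proof,
  p. 15; §5.4 (time zero, the constant `M`); Props. 5.11, 5.12, 5.13). [`Derosa2018`]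
* T. Buckmaster, C. De Lellis, L. Székelyhidi Jr., V. Vicol, CPAM 72 (2019) = arXiv:1701.08678,
  §2.6 "Proof of Proposition 2.1". [`BuckmasterEtAl2018`]
-/

open MeasureTheory Set
open scoped NNReal ENNReal ContDiff

noncomputable section

namespace Literature.Analysis.FluidPDE

namespace DeRosa

/-- The flat three-torus `𝕋³ = (ℝ/ℤ)³`, local notation. -/
local notation "𝕋³" => UnitAddTorus (Fin 3)

/-- Euclidean `ℝ³`, local notation. -/
local notation "ℝ³" => EuclideanSpace ℝ (Fin 3)


/-! ## The stage estimates from the three stages (§5: "Then Proposition 4.1 is just a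
consequence of estimates (5.19)–(5.21), Proposition 5.1 and Proposition 5.5") -/

section HolderGlue

open BDSV

/-- **A spatial Hölder bound survives a `C⁰`-small, `C¹`-controlled perturbation** (the step
"`v̄_q` is bounded in `C^{γ'}`" implicit on p. 15 of De Rosa 2019, proof of Lemma 5.9, where the
bound `‖v_q‖_{γ'} ≤ 1` of §4.2 is used for `v̄_q`; interpolation (A.3) of BDSV, App. A): if every
slice `f(t)`, `t ∈ [0,T]`, is `θ`-Hölder with constant `C_H`, the difference `g - f` has
`‖g - f‖₀ ≤ S`, `[g - f]₁ ≤ D` (`D ≥ 0`) and smooth slices, and `(2S)^{1-θ} (6D)^θ ≤ 1`, then every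
slice `g(t)` is `θ`-Hölder with constant `C_H + 1` (quotient metric of `𝕋³`).
[cite: BuckmasterEtAl2018, App. A (A.3)] -/
theorem holderWith_of_supLE_of_derivSupLE {T : ℝ} {f g : ℝ → 𝕋³ → ℝ³} {CH θ : ℝ≥0}
    {S D : ℝ} (hθ1 : (θ : ℝ) ≤ 1) (hf : ∀ t ∈ Icc 0 T, HolderWith CH θ (f t))
    (hS : SupLE T (fun t x => g t x - f t x) S) (hD0 : 0 ≤ D)
    (hD : DerivSupLE T (fun t x => g t x - f t x) D)
    (hsm : ∀ t ∈ Icc 0 T, FunctionSpaces.Torus.IsSmooth (fun x => g t x - f t x))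
    (hK : (2 * S) ^ (1 - (θ : ℝ)) * (6 * D) ^ (θ : ℝ) ≤ 1) :
    ∀ t ∈ Icc 0 T, HolderWith (Real.toNNReal ((CH : ℝ) + 1)) θ (g t) := by
  intro t ht
  refine BDSV.holderWith_of_norm_sub_le (by positivity) fun x y => ?_
  have hLip := BDSV.lipschitzWith_of_derivSupLE hD0 hD ht (hsm t ht)
  have hint := BDSV.norm_sub_le_interpolate (w := fun x => g t x - f t x)
    (fun x => hS t ht x) hLip θ.coe_nonneg hθ1 x y
  rw [Real.coe_toNNReal _ (by positivity)] at hint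
  have hf' := (hf t ht).dist_le x y
  rw [dist_eq_norm] at hf'
  have hd : 0 ≤ dist x y ^ (θ : ℝ) := Real.rpow_nonneg dist_nonneg _
  calc ‖g t x - g t y‖ = ‖(f t x - f t y) + ((g t x - f t x) - (g t y - f t y))‖ := by
        congr 1; abel
    _ ≤ ‖f t x - f t y‖ + ‖(g t x - f t x) - (g t y - f t y)‖ := norm_add_le _ _
    _ ≤ CH * dist x y ^ (θ : ℝ) +
          (2 * S) ^ (1 - (θ : ℝ)) * (6 * D) ^ (θ : ℝ) * dist x y ^ (θ : ℝ) := add_le_add hf' hint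
    _ ≤ CH * dist x y ^ (θ : ℝ) + 1 * dist x y ^ (θ : ℝ) := by
        gcongr
    _ = ((CH : ℝ) + 1) * dist x y ^ (θ : ℝ) := by ring

variable {β α a b : ℝ}

/-- The interpolated Hölder constant of `v̄_q - v_ℓ` against the parameters: with
`‖v̄_q - v_ℓ‖₀ ≤ C δ_{q+1}^{1/2} ℓ^α` ((5.13)|₀) and `[v̄_q - v_ℓ]₁ ≤ 2C δ_q^{1/2} λ_q` ((5.6)|₀,
(5.15)|₀), `(2 C δ_{q+1}^{1/2} ℓ^α)^{1-θ} (12 C δ_q^{1/2} λ_q)^θ ≤ (2C)^{1-θ}(12C)^θ λ_q^{(1-β)θ} λ_{q+1}^{-β(1-θ)}`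
(`ℓ^α ≤ λ_q^{-α} ≤ 1`, `δ_q^{1/2} = λ_q^{-β}`). [folklore] -/
theorem holderGlueConst_le (ha : 1 ≤ a) (hb : 1 ≤ b) (hβ : 0 ≤ β) (hα : 0 ≤ α) {θ : ℝ}
    (hθ1 : θ ≤ 1) {Cm : ℝ} (hCm : 0 ≤ Cm) (q : ℕ) :
    (2 * (Cm * (Real.sqrt (amp β a b (q + 1)) * mollScale β α a b q ^ α))) ^ (1 - θ) *
        (6 * (2 * Cm * (Real.sqrt (amp β a b q) * freq a b q))) ^ θ ≤
      ((2 * Cm) ^ (1 - θ) * (12 * Cm) ^ θ) *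
        (freq a b q ^ ((1 - β) * θ) * freq a b (q + 1) ^ (-(β * (1 - θ)))) := by
  have hf0 := freq_pos (b := b) ha q
  have hf1 := freq_pos (b := b) ha (q + 1)
  have hℓ0 : 0 < mollScale β α a b q := mollScale_pos ha q
  have hℓα0 : 0 ≤ mollScale β α a b q ^ α := Real.rpow_nonneg hℓ0.le _
  have hr1 : 0 ≤ freq a b (q + 1) ^ (-β) := Real.rpow_nonneg hf1.le _
  -- first factor: `2 C δ_{q+1}^{1/2} ℓ^α ≤ 2C λ_{q+1}^{-β}`
  have h1 : 2 * (Cm * (Real.sqrt (amp β a b (q + 1)) * mollScale β α a b q ^ α)) ≤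
      2 * Cm * freq a b (q + 1) ^ (-β) := by
    rw [sqrt_amp ha]
    have hℓ1 : mollScale β α a b q ^ α ≤ 1 :=
      (mollScale_rpow_le ha hb hβ hα q).trans (freq_rpow_neg_le_one ha hα q)
    calc 2 * (Cm * (freq a b (q + 1) ^ (-β) * mollScale β α a b q ^ α))
        ≤ 2 * (Cm * (freq a b (q + 1) ^ (-β) * 1)) := by gcongr
      _ = 2 * Cm * freq a b (q + 1) ^ (-β) := by ring
  have h1nonneg : 0 ≤ 2 * (Cm * (Real.sqrt (amp β a b (q + 1)) * mollScale β α a b q ^ α)) :=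
    mul_nonneg zero_le_two (mul_nonneg hCm (mul_nonneg (Real.sqrt_nonneg _) hℓα0))
  have h1' : (2 * (Cm * (Real.sqrt (amp β a b (q + 1)) * mollScale β α a b q ^ α))) ^ (1 - θ) ≤
      (2 * Cm) ^ (1 - θ) * freq a b (q + 1) ^ (-(β * (1 - θ))) := by
    calc (2 * (Cm * (Real.sqrt (amp β a b (q + 1)) * mollScale β α a b q ^ α))) ^ (1 - θ)
        ≤ (2 * Cm * freq a b (q + 1) ^ (-β)) ^ (1 - θ) :=
          Real.rpow_le_rpow h1nonneg h1 (by linarith)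
      _ = (2 * Cm) ^ (1 - θ) * (freq a b (q + 1) ^ (-β)) ^ (1 - θ) :=
          Real.mul_rpow (by positivity) hr1
      _ = (2 * Cm) ^ (1 - θ) * freq a b (q + 1) ^ (-(β * (1 - θ))) := by
          rw [← Real.rpow_mul hf1.le]
          congr 2
          ring
  -- second factor: `12 C δ_q^{1/2} λ_q = 12 C λ_q^{1-β}`
  have h2 : 6 * (2 * Cm * (Real.sqrt (amp β a b q) * freq a b q)) =
      12 * Cm * freq a b q ^ (1 - β) := by
    rw [sqrt_amp ha, rpow_mul_self_eq hf0, show -β + 1 = 1 - β by ring]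
    ring
  have h2' : (6 * (2 * Cm * (Real.sqrt (amp β a b q) * freq a b q))) ^ θ =
      (12 * Cm) ^ θ * freq a b q ^ ((1 - β) * θ) := by
    rw [h2, Real.mul_rpow (by positivity) (Real.rpow_nonneg hf0.le _), ← Real.rpow_mul hf0.le]
  rw [h2']
  have hR : 0 ≤ (12 * Cm) ^ θ * freq a b q ^ ((1 - β) * θ) :=
    mul_nonneg (Real.rpow_nonneg (by positivity) _) (Real.rpow_nonneg hf0.le _)
  calc (2 * (Cm * (Real.sqrt (amp β a b (q + 1)) * mollScale β α a b q ^ α))) ^ (1 - θ) *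
        ((12 * Cm) ^ θ * freq a b q ^ ((1 - β) * θ))
      ≤ ((2 * Cm) ^ (1 - θ) * freq a b (q + 1) ^ (-(β * (1 - θ)))) *
          ((12 * Cm) ^ θ * freq a b q ^ ((1 - β) * θ)) :=
        mul_le_mul_of_nonneg_right h1' hR
    _ = ((2 * Cm) ^ (1 - θ) * (12 * Cm) ^ θ) *
          (freq a b q ^ ((1 - β) * θ) * freq a b (q + 1) ^ (-(β * (1 - θ)))) := by ring

/-- **Threshold for the Hölder glue**: for `θ < β`, `b ≥ 1` the `a`-exponent
`(1-β)θ - bβ(1-θ)` of `λ_q^{(1-β)θ} λ_{q+1}^{-β(1-θ)}` is negative (it is at most `θ - β`), so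
`K λ_q^{(1-β)θ} λ_{q+1}^{-β(1-θ)} ≤ 1` for every `q` once `a` is large
(`BDSV.exists_freq_triple_le`). This is the uniformity in `q` of "`v_q` (hence `v̄_q`) is bounded
in `C⁰_t C^{β'}_x` for `β' < β`" (De Rosa 2019, §4.2). [cite: Derosa2018, §4.2] -/
theorem exists_threshold_holderGlue (hβ : 0 < β) (hb : 1 ≤ b) {θ : ℝ} (hθβ : θ < β)
    (hθ1 : θ ≤ 1) (K : ℝ) :
    ∃ a₁ : ℝ, 1 < a₁ ∧ ∀ a : ℝ, a₁ ≤ a → ∀ q : ℕ,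
      K * (freq a b q ^ ((1 - β) * θ) * freq a b (q + 1) ^ (-(β * (1 - θ)))) ≤ 1 := by
  have hE : (1 - β) * θ + b * (-(β * (1 - θ))) + b ^ 2 * 0 < 0 := by
    have h1 : 0 ≤ (b - 1) * (β * (1 - θ)) := mul_nonneg (by linarith) (mul_nonneg hβ.le (by linarith))
    have e1 : (1 - β) * θ + b * (-(β * (1 - θ))) + b ^ 2 * 0 =
        (θ - β) - (b - 1) * (β * (1 - θ)) := by ring
    rw [e1]
    linarith
  obtain ⟨a₁, ha₁, h⟩ := exists_freq_triple_le hb hE K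
  refine ⟨a₁, ha₁, fun a ha q => ?_⟩
  have key := h a ha q
  rwa [Real.rpow_zero, mul_one] at key

end HolderGlue

section Glue

open BDSV

/-- **The three stages imply the stage estimates** (De Rosa 2019, §5.3, p. 14: "Then
Proposition 4.1 is just a consequence of estimates (5.19)–(5.21), Proposition 5.1 and
Proposition 5.5 (again, a detailed proof can be found in [BDLSV2017])" — here the part of that
sentence that COMPOSES the three stages; the fractional twin of
`BDSV.stagesEstimate_of_threeStages`). From `DeRosa.mollificationStage` (Prop. 5.1),
`DeRosa.gluingStage` (§5.2: Cor. 5.2, Props. 5.3–5.5) and `DeRosa.perturbationStage` (§§5.3–5.5: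
Props. 5.11–5.13): for the parameters of Prop. 4.1 with `γ < β`, an exponent `θ ∈ (γ, β)` and a
Hölder constant `C_H`, the stage-`q` triple with (4.7)–(4.10) and `[v_q(t)]_θ ≤ C_H` yields
`v_ℓ`, `v̄_q`, `(v_{q+1}, p_{q+1}, R̊_{q+1})` with (5.5), (5.6)|₀, (5.13)|₀, (5.15)|₀, (5.19),
(5.20), (5.21) and `v_{q+1}(·,0) = Ψ (e 0) (v_q(·,0))`. Glue: the energy gap of §5.3
("as a corollary of (4.10), (5.8) and (5.18), by choosing `a` sufficiently large") through
`2C ℓ^α ≤ λ_q^{-α}/2`; `‖v̄_q‖₀ ≤ 3` ((4.9), (5.5), (5.13)); the Hölder bound of `v_ℓ` is the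
mollification stage's transfer clause and that of `v̄_q` is `holderWith_of_supLE_of_derivSupLE`
with `exists_threshold_holderGlue`; `Ψ = Ψ₃(e(0)) ∘ Ψ₁` since `v̄_q(·,0) = v_ℓ(·,0) = Ψ₁(v_q(·,0))`.
[cite: Derosa2018, §5.3 (p. 14, the energy gap and "Then Proposition 4.1 is just a consequence …"); §4.2] -/
theorem stageEstimates_of_threeStages (h1 : DeRosa.mollificationStage)
    (h2 : DeRosa.gluingStage) (h3 : DeRosa.perturbationStage) :
    ∃ M : ℝ, 0 < M ∧
    ∀ β : ℝ, 0 < β → β < 1 / 3 → ∀ γ : ℝ, 0 < γ → γ < β →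
      ∀ b : ℝ, 1 < b → b < (1 - β) / (2 * β) → b < 4 / 3 →
        ∀ θ : ℝ≥0, γ < (θ : ℝ) → (θ : ℝ) < β →
          ∃ α₀ : ℝ, 0 < α₀ ∧ ∀ α : ℝ, 0 < α → α < α₀ → ∀ CH : ℝ≥0,
            ∃ C a₀ : ℝ, 1 < a₀ ∧ ∀ a : ℝ, a₀ ≤ a → ∀ ν : ℝ, 0 < ν → ν < 1 →
              ∀ T : ℝ, 0 < T → ∀ q : ℕ, ∃ Ψ : ℝ → (𝕋³ → ℝ³) → (𝕋³ → ℝ³),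
                ∀ e : ℝ → ℝ, BDSV.IsNormalisedProfile T e →
                  ∀ (v : ℝ → 𝕋³ → ℝ³) (p : ℝ → 𝕋³ → ℝ) (R : ℝ → 𝕋³ → Fin 3 → ℝ³),
                    Torus.IsFracNSReynoldsOn (Icc 0 T) γ ν v p R →
                    BDSV.InductiveEstimates M β α a b T e q v R →
                    (∀ t ∈ Icc 0 T, HolderWith CH θ (v t)) →
                      ∃ (vℓ vbar v' : ℝ → 𝕋³ → ℝ³) (p' : ℝ → 𝕋³ → ℝ)
                        (R' : ℝ → 𝕋³ → Fin 3 → ℝ³),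
                        (∀ t ∈ Icc 0 T, FunctionSpaces.Torus.IsSmooth (vℓ t)) ∧
                        (∀ t ∈ Icc 0 T, FunctionSpaces.Torus.IsSmooth (vbar t)) ∧
                        Torus.IsFracNSReynoldsOn (Icc 0 T) γ ν v' p' R' ∧
                        BDSV.SupLE T (fun t x => vℓ t x - v t x)
                          (C * (Real.sqrt (BDSV.amp β a b (q + 1)) * BDSV.freq a b q ^ (-α))) ∧
                        (∃ B₀ B₁ : ℝ, BDSV.SupLE T vℓ B₀ ∧ BDSV.DerivSupLE T vℓ B₁ ∧
                          B₀ + B₁ ≤ C * (Real.sqrt (BDSV.amp β a b q) * BDSV.freq a b q)) ∧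
                        BDSV.SupLE T (fun t x => vbar t x - vℓ t x)
                          (C * (Real.sqrt (BDSV.amp β a b (q + 1)) *
                            BDSV.mollScale β α a b q ^ α)) ∧
                        (∃ B₀ B₁ : ℝ, BDSV.SupLE T vbar B₀ ∧ BDSV.DerivSupLE T vbar B₁ ∧
                          B₀ + B₁ ≤ C * (Real.sqrt (BDSV.amp β a b q) * BDSV.freq a b q)) ∧
                        BDSV.VelocityIncrementBound (M / 2) β a b T q
                          (fun t x => v' t x - vbar t x) ∧
                        BDSV.SupLE T R' (C * (Real.sqrt (BDSV.amp β a b (q + 1)) *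
                          Real.sqrt (BDSV.amp β a b q) * BDSV.freq a b q *
                          BDSV.freq a b (q + 1) ^ (-1 + 4 * α))) ∧
                        (∀ t ∈ Icc 0 T, |e t - (∫ x, ‖v' t x‖ ^ 2) - BDSV.amp β a b (q + 2) / 2| ≤
                          C * (Real.sqrt (BDSV.amp β a b q) * Real.sqrt (BDSV.amp β a b (q + 1)) *
                            BDSV.freq a b q ^ (1 + 2 * α) * (BDSV.freq a b (q + 1))⁻¹)) ∧
                        v' 0 = Ψ (e 0) (v 0) := by
  obtain ⟨M, hM, h3M⟩ := h3
  refine ⟨M, hM, fun β hβ hβ3 γ hγ hγβ b hb hbβ hb43 θ hγθ hθβ => ?_⟩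
  obtain ⟨α₁, hα₁, h1α⟩ := h1 M hM β hβ hβ3 b hb hbβ
  obtain ⟨α₂, hα₂, h2α⟩ := h2 M hM β hβ hβ3 γ hγ hγβ b hb hbβ hb43 θ hγθ hθβ
  obtain ⟨α₃, hα₃, h3α⟩ := h3M β hβ hβ3 γ hγ hγβ b hb hbβ hb43 θ hγθ hθβ
  refine ⟨min (min α₁ α₂) α₃, lt_min (lt_min hα₁ hα₂) hα₃, fun α hα hαlt CH => ?_⟩
  have hαlt₁ : α < α₁ := lt_of_lt_of_le hαlt ((min_le_left _ _).trans (min_le_left _ _))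
  have hαlt₂ : α < α₂ := lt_of_lt_of_le hαlt ((min_le_left _ _).trans (min_le_right _ _))
  have hαlt₃ : α < α₃ := lt_of_lt_of_le hαlt (min_le_right _ _)
  have hθ1 : (θ : ℝ) ≤ 1 := by linarith
  have hγ1 : γ < 1 := by linarith
  have hβ1 : β < 1 := by linarith
  -- thread the constants: mollification → gluing → perturbation
  obtain ⟨C₁, a₁, ha₁, h1a⟩ := h1α α hα hαlt₁
  obtain ⟨Nbar, h3N⟩ := h3α α hα hαlt₃
  obtain ⟨C₂, a₂, ha₂, h2a⟩ := h2α α hα hαlt₂ Nbar C₁ CH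
  obtain ⟨C₃, a₃, ha₃, h3a⟩ := h3N C₂ 3 (Real.toNNReal ((CH : ℝ) + 1))
  set Cm : ℝ := max (max (C₁ 0) C₂) (max C₃ 1) with hCm
  have hC₁m : C₁ 0 ≤ Cm := (le_max_left _ _).trans (le_max_left _ _)
  have hC₂m : C₂ ≤ Cm := (le_max_right _ _).trans (le_max_left _ _)
  have hC₃m : C₃ ≤ Cm := (le_max_left _ _).trans (le_max_right _ _)
  have hCm1 : 1 ≤ Cm := (le_max_right _ _).trans (le_max_right _ _)
  have hCm0 : 0 ≤ Cm := zero_le_one.trans hCm1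
  -- the three parameter thresholds of the glue
  have hb1 : (1 : ℝ) ≤ b := hb.le
  obtain ⟨a₄, ha₄, h4⟩ := exists_threshold_rpow_neg hb1 hα (by norm_num : (0 : ℝ) < 16) Cm
  have hα2 : 0 < 3 * α ^ 2 / 2 := by positivity
  obtain ⟨a₅, ha₅, h5⟩ := exists_threshold_rpow_neg hb1 hα2 (by norm_num : (0 : ℝ) < 4) Cm
  obtain ⟨a₆, ha₆, h6⟩ := exists_threshold_holderGlue hβ hb1 hθβ hθ1
    ((2 * Cm) ^ (1 - (θ : ℝ)) * (12 * Cm) ^ (θ : ℝ))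
  refine ⟨2 * Cm, max (max (max a₁ a₂) (max a₃ a₄)) (max a₅ a₆),
    lt_max_of_lt_left (lt_max_of_lt_left (lt_max_of_lt_left ha₁)),
    fun a ha ν hν hν1 T hT q => ?_⟩
  have ha' := le_of_max_le_left ha
  have ha5 : a₅ ≤ a := le_of_max_le_left (le_of_max_le_right ha)
  have ha6 : a₆ ≤ a := le_of_max_le_right (le_of_max_le_right ha)
  have ha1' : a₁ ≤ a := le_of_max_le_left (le_of_max_le_left ha')
  have ha2' : a₂ ≤ a := le_of_max_le_right (le_of_max_le_left ha')
  have ha3' : a₃ ≤ a := le_of_max_le_left (le_of_max_le_right ha')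
  have ha4' : a₄ ≤ a := le_of_max_le_right (le_of_max_le_right ha')
  have ha1 : (1 : ℝ) ≤ a := by linarith
  -- the time-zero maps of the mollification and perturbation stages at this `a, ν, T, q`
  obtain ⟨Ψ₁, h1Ψ⟩ := h1a a ha1' γ hγ hγ1 ν hν T hT q
  obtain ⟨Ψ₃, h3Ψ⟩ := h3a a ha3' ν hν hν1 T hT q
  refine ⟨fun e₀ v₀ => Ψ₃ e₀ (Ψ₁ v₀), fun e he v p R hER hIE hHol => ?_⟩
  -- positivity of the parameters
  have hT0 : (0 : ℝ) ≤ T := hT.le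
  have hf0 := freq_pos (b := b) ha1 q
  have hf1 := freq_pos (b := b) ha1 (q + 1)
  have hA1 : 0 < amp β a b (q + 1) := amp_pos ha1 _
  have hs0 : 0 ≤ Real.sqrt (amp β a b q) := Real.sqrt_nonneg _
  have hs1 : 0 ≤ Real.sqrt (amp β a b (q + 1)) := Real.sqrt_nonneg _
  have hs1' : Real.sqrt (amp β a b (q + 1)) ≤ 1 := Real.sqrt_le_one.2 (amp_le_one ha1 hβ.le _)
  have hℓ0 : 0 < mollScale β α a b q := mollScale_pos ha1 q
  have hr0 : 0 ≤ freq a b q ^ (-α) := Real.rpow_nonneg hf0.le _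
  have hr0' : freq a b q ^ (-α) ≤ 1 := freq_rpow_neg_le_one ha1 hα.le q
  have hrℓ : 0 ≤ mollScale β α a b q ^ α := Real.rpow_nonneg hℓ0.le _
  have hr1 : 0 ≤ freq a b (q + 1) ^ (-1 + 4 * α) := Real.rpow_nonneg hf1.le _
  have hr2 : 0 ≤ freq a b q ^ (1 + 2 * α) := Real.rpow_nonneg hf0.le _
  have hi1 : (0 : ℝ) ≤ (freq a b (q + 1))⁻¹ := inv_nonneg.2 hf1.le
  have hℓα : mollScale β α a b q ^ α ≤ freq a b q ^ (-α) :=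
    mollScale_rpow_le ha1 hb1 hβ.le hα.le q
  have hsf0 : 0 ≤ Real.sqrt (amp β a b q) * freq a b q := mul_nonneg hs0 hf0.le
  -- the thresholds at this `a`, `q`
  have hG2 : Cm * freq a b q ^ (-α) ≤ 1 := by
    have := h4 a ha4' q
    linarith
  have hG1 : 2 * Cm * mollScale β α a b q ^ α ≤ freq a b q ^ (-α) / 2 := by
    have k1 := mollScale_rpow_le_mul ha1 hb1 hβ.le hα.le q
    have k2 : Cm * freq a b q ^ (-(3 * α ^ 2 / 2)) ≤ 4 / 16 := h5 a ha5 q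
    have k3 := mul_le_mul_of_nonneg_left k1 hCm0
    have k4 : Cm * (freq a b q ^ (-α) * freq a b q ^ (-(3 * α ^ 2 / 2))) =
        freq a b q ^ (-α) * (Cm * freq a b q ^ (-(3 * α ^ 2 / 2))) := by ring
    have k5 := mul_le_mul_of_nonneg_left k2 hr0
    linarith
  have hG3 : ((2 * Cm) ^ (1 - (θ : ℝ)) * (12 * Cm) ^ (θ : ℝ)) *
      (freq a b q ^ ((1 - β) * θ) * freq a b (q + 1) ^ (-(β * (1 - θ)))) ≤ 1 := h6 a ha6 q
  -- stage 1: mollification (Prop. 5.1)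
  obtain ⟨vℓ, pℓ, Rℓ, hERℓ, h12, h13, h14, h15, hHolℓ, h0ℓ⟩ :=
    h1Ψ v p R hER hIE.stress_le hIE.velocity_C1_le
  -- stage 2: gluing (§5.2), fed the Hölder bound of `v_ℓ`
  obtain ⟨vbar, pbar, Rbar, hERb, hsupp, h18, h19, h20, h21, h22, h0b⟩ :=
    h2a a ha2' ν hν hν1 T hT q vℓ pℓ Rℓ hERℓ h13 h14 (hHolℓ θ CH hHol)
  -- slices are smooth
  have hvℓs : ∀ t ∈ Icc 0 T, FunctionSpaces.Torus.IsSmooth (vℓ t) := fun t ht =>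
    hERℓ.smooth_velocity.isSmooth_slice ht
  have hvbars : ∀ t ∈ Icc 0 T, FunctionSpaces.Torus.IsSmooth (vbar t) := fun t ht =>
    hERb.smooth_velocity.isSmooth_slice ht
  -- weaken the constants to `Cm`
  have h12' : SupLE T (fun t x => vℓ t x - v t x)
      (Cm * (Real.sqrt (amp β a b (q + 1)) * freq a b q ^ (-α))) :=
    h12.mono (mul_le_mul_of_nonneg_right hC₁m (mul_nonneg hs1 hr0))
  have h18' : SupLE T (fun t x => vbar t x - vℓ t x)
      (Cm * (Real.sqrt (amp β a b (q + 1)) * mollScale β α a b q ^ α)) :=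
    h18.mono (mul_le_mul_of_nonneg_right hC₂m (mul_nonneg hs1 hrℓ))
  have h15' : ∀ t ∈ Icc 0 T, |(∫ x, ‖v t x‖ ^ 2) - ∫ x, ‖vℓ t x‖ ^ 2| ≤
      Cm * (amp β a b (q + 1) * mollScale β α a b q ^ α) := fun t ht =>
    (h15 t ht).trans (mul_le_mul_of_nonneg_right hC₁m (mul_nonneg hA1.le hrℓ))
  have h22' : ∀ t ∈ Icc 0 T, |(∫ x, ‖vbar t x‖ ^ 2) - ∫ x, ‖vℓ t x‖ ^ 2| ≤
      Cm * (amp β a b (q + 1) * mollScale β α a b q ^ α) := fun t ht =>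
    (h22 t ht).trans (mul_le_mul_of_nonneg_right hC₂m (mul_nonneg hA1.le hrℓ))
  -- (5.6)|₀ and (5.15)|₀ as sup bounds of the fields and their first partials
  have hBm : 0 ≤ Cm * (Real.sqrt (amp β a b q) * freq a b q) := mul_nonneg hCm0 hsf0
  have h13' : HolderSupLE T vℓ 1 0 (Cm * (Real.sqrt (amp β a b q) * freq a b q)) := by
    have k := h13 0
    rw [Nat.cast_zero, neg_zero, Real.rpow_zero, mul_one, zero_add] at k
    exact k.mono (mul_le_mul_of_nonneg_right hC₁m hsf0)
  have h19' : HolderSupLE T vbar 1 0 (Cm * (Real.sqrt (amp β a b q) * freq a b q)) := by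
    have k := h19 0 (Nat.zero_le _)
    rw [Nat.cast_zero, neg_zero, Real.rpow_zero, mul_one, zero_add] at k
    exact k.mono (mul_le_mul_of_nonneg_right hC₂m hsf0)
  have hℓder : DerivSupLE T vℓ (Cm * (Real.sqrt (amp β a b q) * freq a b q)) :=
    h13'.derivSupLE_of_one hBm hvℓs
  have hbder : DerivSupLE T vbar (Cm * (Real.sqrt (amp β a b q) * freq a b q)) :=
    h19'.derivSupLE_of_one hBm hvbars
  -- `‖v̄_q‖₀ ≤ 3` ((4.9), (5.5), (5.13))
  have hvbar0 : SupLE T vbar 3 := by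
    intro t ht x
    have e1 : vbar t x = v t x + (vℓ t x - v t x) + (vbar t x - vℓ t x) := by abel
    rw [e1]
    refine (norm_add₃_le).trans ?_
    have k1 := hIE.velocity_le t ht x
    have k2 := h12' t ht x
    have k3 := h18' t ht x
    have k4 : Cm * (Real.sqrt (amp β a b (q + 1)) * freq a b q ^ (-α)) ≤ 1 := by
      have : Real.sqrt (amp β a b (q + 1)) * freq a b q ^ (-α) ≤ freq a b q ^ (-α) := by
        calc _ ≤ 1 * freq a b q ^ (-α) := mul_le_mul_of_nonneg_right hs1' hr0
          _ = _ := one_mul _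
      have := mul_le_mul_of_nonneg_left this hCm0
      linarith
    have k5 : Cm * (Real.sqrt (amp β a b (q + 1)) * mollScale β α a b q ^ α) ≤ 1 := by
      have : Real.sqrt (amp β a b (q + 1)) * mollScale β α a b q ^ α ≤ freq a b q ^ (-α) := by
        calc _ ≤ 1 * freq a b q ^ (-α) := mul_le_mul hs1' hℓα hrℓ zero_le_one
          _ = _ := one_mul _
      have := mul_le_mul_of_nonneg_left this hCm0
      linarith
    have k6 : 0 ≤ Real.sqrt (amp β a b q) := hs0
    linarith
  -- the energy gap of §5.3 ((4.10), (5.8), (5.18))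
  have hgap : ∀ t ∈ Icc 0 T,
      amp β a b (q + 1) * freq a b q ^ (-α) / 2 ≤ e t - ∫ x, ‖vbar t x‖ ^ 2 ∧
        e t - ∫ x, ‖vbar t x‖ ^ 2 ≤ 2 * amp β a b (q + 1) := by
    intro t ht
    have k1 := hIE.energy_ge t ht
    have k2 := hIE.energy_le t ht
    have k3 := abs_le.1 (h15' t ht)
    have k4 := abs_le.1 (h22' t ht)
    have k5 : 2 * (Cm * (amp β a b (q + 1) * mollScale β α a b q ^ α)) ≤
        amp β a b (q + 1) * freq a b q ^ (-α) / 2 := by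
      have := mul_le_mul_of_nonneg_left hG1 hA1.le
      linarith
    have k6 : amp β a b (q + 1) * freq a b q ^ (-α) ≤ amp β a b (q + 1) := by
      calc _ ≤ amp β a b (q + 1) * 1 := mul_le_mul_of_nonneg_left hr0' hA1.le
        _ = _ := mul_one _
    constructor
    · linarith [k3.2, k4.1]
    · linarith [k3.1, k4.2]
  -- the Hölder bound of `v̄_q` (§4.2 / p. 15): interpolation of (5.13)|₀ against (5.6)|₀, (5.15)|₀
  have hHolb : ∀ t ∈ Icc 0 T, HolderWith (Real.toNNReal ((CH : ℝ) + 1)) θ (vbar t) := by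
    have hD0 : 0 ≤ 2 * Cm * (Real.sqrt (amp β a b q) * freq a b q) := by positivity
    refine holderWith_of_supLE_of_derivSupLE hθ1 (hHolℓ θ CH hHol) h18' hD0 ?_ ?_ ?_
    · -- `[v̄_q - v_ℓ]₁ ≤ [v̄_q]₁ + [v_ℓ]₁`
      intro i t ht x
      show ‖FunctionSpaces.Torus.partialDeriv i (fun y => vbar t y - vℓ t y) x‖ ≤ _
      rw [partialDeriv_sub_of_isSmooth (hvbars t ht) (hvℓs t ht)]
      have k1 := hbder i t ht x
      have k2 := hℓder i t ht x
      calc _ ≤ ‖FunctionSpaces.Torus.partialDeriv i (vbar t) x‖ +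
            ‖FunctionSpaces.Torus.partialDeriv i (vℓ t) x‖ := norm_sub_le _ _
        _ ≤ Cm * (Real.sqrt (amp β a b q) * freq a b q) +
            Cm * (Real.sqrt (amp β a b q) * freq a b q) := add_le_add k1 k2
        _ = 2 * Cm * (Real.sqrt (amp β a b q) * freq a b q) := by ring
    · exact fun t ht => (hvbars t ht).sub (hvℓs t ht)
    · exact (holderGlueConst_le ha1 hb1 hβ.le hα.le hθ1 hCm0 q).trans hG3
  -- stage 3: perturbation (§§5.3–5.5)
  obtain ⟨v', p', R', hER', h23, h61, h62, h0'⟩ :=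
    h3Ψ e he vbar pbar Rbar hERb hsupp hvbar0 h19 h20 h21 hHolb hgap
  -- read off the seven estimates and the time-zero clause
  have hCm2 : Cm ≤ 2 * Cm := by linarith
  refine ⟨vℓ, vbar, v', p', R', hvℓs, hvbars, hER', ?_, ?_, ?_, ?_, h23, ?_, ?_, ?_⟩
  · -- (5.5)
    exact h12'.mono (mul_le_mul_of_nonneg_right hCm2 (mul_nonneg hs1 hr0))
  · -- (5.6), `N = 0`
    exact ⟨_, _, h13'.supLE_of_one hBm, hℓder, by linarith⟩
  · -- (5.13)|₀
    exact h18'.mono (mul_le_mul_of_nonneg_right hCm2 (mul_nonneg hs1 hrℓ))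
  · -- (5.15), `N = 0`
    exact ⟨_, _, h19'.supLE_of_one hBm, hbder, by linarith⟩
  · -- (5.20) = Prop. 5.13
    exact h61.mono (mul_le_mul_of_nonneg_right (hC₃m.trans hCm2)
      (mul_nonneg (mul_nonneg (mul_nonneg hs1 hs0) hf0.le) hr1))
  · -- (5.21) = Prop. 5.12
    intro t ht
    exact (h62 t ht).trans (mul_le_mul_of_nonneg_right (hC₃m.trans hCm2)
      (mul_nonneg (mul_nonneg (mul_nonneg hs0 hs1) hr2) hi1))
  · -- time zero: `v_{q+1}(·,0) = Ψ₃ (e 0) (v̄_q(·,0))`, `v̄_q(·,0) = v_ℓ(·,0) = Ψ₁ (v_q(·,0))`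
    rw [h0', h0b, h0ℓ]

end Glue

end DeRosa

end Literature.Analysis.FluidPDE
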